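import Mathlib
import HarnessLib
import Literature.Computability.AlgebraicComplexity.PatternExpressions
import Summits.ValiantsHypothesis.ValiantsHypothesis.Theorems.MonotoneRestorationOrbitRestorationQPCloseAlgebra
import Summits.ValiantsHypothesis.ValiantsHypothesis.Theorems.MonotoneRestorationOrbitCompressionQPCompressionFloors

/-!
# Route MonotoneRestoration — aside `OrbitCompressionQP` (stmt-ValiantsHypothesis-18332), line
# `expression_compression`: CLOSURE CALCULUS for the conclusion of `stub_narrowExpressionCompression`

The open stub of the line concludes that a family is NARROW OF QUASI-POLYNOMIAL LENGTH:
`NQP(f) :≡ ∃ c, ∀ n ≥ 1, ∃ k l (e : PatternExpr ℂ k l), n^{k+l} ≤ 2^{(log₂ n + c)^c} ∧ |e| ≤ 2^{(log₂ n + c)^c} ∧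
e.close n = f n` (spelled out below; no definition is introduced).  The circuit side of the route has its
closure calculus (THEOREM ζ, Z1–Z13); this file is the expression-side analogue, with exact length
bookkeeping at a single level and the family-level closure properties — the tools any attack on the stub
above its floors (`Theorems/…OrbitCompressionQPCompressionFloors.lean`) composes with:

* single level (`F` any commutative semiring): `length_sumAll` (`|sumAll e| = |e| + l + k`),
  `exists_close_eq_mul_len` (`close e₁ · close e₂ = close e`, `|e| = |e₁| + |e₂| + (k + l) + 1`, via
  `OrbitRestorationQPHomPolyClose.close_mul_sumAll`), `exists_value_eq_pad` / `exists_close_eq_pad`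
  (PADDING an expression with idle labels `k ≤ K`, `l ≤ L`: same length, `close` rescaled by
  `n^{K-k} · n^{L-l}`), `exists_close_eq_collapse` (at `n = 1`, one label a side suffices, same length);
* arithmetic: `labels_le_of_pow_le` (`n ≥ 2`, `n^m ≤ 2^M ⇒ m ≤ M`), `qp_combine`
  (`(X+2)(Y+2) ≤ 2^{(log₂ n + c)^c}` for `X, Y` quasi-polynomial);
* family level over `ℂ`: `narrowQP_smul` (scalar families), `narrowQP_add` (sums: pad to common labels,
  rescale, add), `narrowQP_mul` (products: for `n ≥ 2` pad and multiply — the label count enters the length,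
  and `n^{k+l} ≤ 2^{polylog}` bounds it only for `n ≥ 2`; at the level `n = 1` all labels are first
  collapsed to one a side, `exists_close_eq_collapse`).

Helper file (`--supports stmt-ValiantsHypothesis-18332`); def-free; nothing here is a named fact; VP ≠ VNP is
not moved.
-/

noncomputable section

open MvPolynomial

-- `Summit.ValiantsHypothesis.ValiantsHypothesis.…` is the tree's single-conjunct layout (Sub = Summit).
set_option linter.dupNamespace false

namespace Summit.ValiantsHypothesis.ValiantsHypothesis.Theorems

namespace NarrowClosure

open Literature.Computability.AlgebraicComplexity OrbitRestorationQPHomPolyClose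

/-! ### Single level: products with length, padding -/

section SingleLevel

variable {F : Type} {k l : ℕ}

/-- Summing out a list of row labels adds its length. [folklore] -/
theorem length_foldr_sumRow (Lr : List (Fin k)) (e : PatternExpr F k l) :
    (Lr.foldr PatternExpr.sumRow e).length = e.length + Lr.length := by
  induction Lr with
  | nil => simp
  | cons a L ih => simp [PatternExpr.length, ih]; omega

/-- Summing out a list of column labels adds its length. [folklore] -/
theorem length_foldr_sumCol (Lc : List (Fin l)) (e : PatternExpr F k l) :
    (Lc.foldr PatternExpr.sumCol e).length = e.length + Lc.length := by
  induction Lc with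
  | nil => simp
  | cons a L ih => simp [PatternExpr.length, ih]; omega

/-- `|sumAll e| = |e| + l + k`. [folklore] -/
theorem length_sumAll (e : PatternExpr F k l) :
    ((List.finRange k).foldr PatternExpr.sumRow ((List.finRange l).foldr PatternExpr.sumCol e)).length =
      e.length + l + k := by
  rw [length_foldr_sumRow, length_foldr_sumCol, List.length_finRange, List.length_finRange]

variable [CommSemiring F]

/-- **Products with length**: `close e₁ · close e₂ = close e` with `|e| = |e₁| + |e₂| + (k + l) + 1`.
[folklore] -/
theorem exists_close_eq_mul_len (n : ℕ) (e₁ e₂ : PatternExpr F k l) :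
    ∃ e : PatternExpr F k l, e.length = e₁.length + e₂.length + (k + l) + 1 ∧
      e.close n = e₁.close n * e₂.close n := by
  refine ⟨PatternExpr.mul ((List.finRange k).foldr PatternExpr.sumRow
    ((List.finRange l).foldr PatternExpr.sumCol e₁)) e₂, ?_, close_mul_sumAll n e₁ e₂⟩
  rw [PatternExpr.length, length_sumAll]
  ring

/-- **Padding with idle labels, values**: an expression with `k ≤ K` row and `l ≤ L` column labels has a twin
with `K` and `L` labels, of the same length, whose value at `(ρ, γ)` is the original value at the restricted
assignments `(ρ ∘ castLE, γ ∘ castLE)`. [folklore] -/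
theorem exists_value_eq_pad {K L : ℕ} (hk : k ≤ K) (hl : l ≤ L) (n : ℕ) :
    ∀ e : PatternExpr F k l, ∃ e' : PatternExpr F K L, e'.length = e.length ∧
      ∀ (ρ : Fin K → Fin n) (γ : Fin L → Fin n),
        e'.value n ρ γ = e.value n (ρ ∘ Fin.castLE hk) (γ ∘ Fin.castLE hl) := by
  intro e
  induction e with
  | edge a b => exact ⟨PatternExpr.edge (Fin.castLE hk a) (Fin.castLE hl b), rfl, fun ρ γ => by simp⟩
  | const c => exact ⟨PatternExpr.const c, rfl, fun ρ γ => by simp⟩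
  | add e₁ e₂ ih₁ ih₂ =>
    obtain ⟨e₁', h₁, hv₁⟩ := ih₁
    obtain ⟨e₂', h₂, hv₂⟩ := ih₂
    exact ⟨PatternExpr.add e₁' e₂', by simp [PatternExpr.length, h₁, h₂], fun ρ γ => by simp [hv₁, hv₂]⟩
  | mul e₁ e₂ ih₁ ih₂ =>
    obtain ⟨e₁', h₁, hv₁⟩ := ih₁
    obtain ⟨e₂', h₂, hv₂⟩ := ih₂
    exact ⟨PatternExpr.mul e₁' e₂', by simp [PatternExpr.length, h₁, h₂], fun ρ γ => by simp [hv₁, hv₂]⟩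
  | sumRow a e ih =>
    obtain ⟨e', h, hv⟩ := ih
    refine ⟨PatternExpr.sumRow (Fin.castLE hk a) e', by simp [PatternExpr.length, h], fun ρ γ => ?_⟩
    simp only [PatternExpr.value_sumRow, hv]
    refine Finset.sum_congr rfl fun v _ => ?_
    rw [Function.update_comp_eq_of_injective _ (Fin.castLE_injective hk)]
  | sumCol b e ih =>
    obtain ⟨e', h, hv⟩ := ih
    refine ⟨PatternExpr.sumCol (Fin.castLE hl b) e', by simp [PatternExpr.length, h], fun ρ γ => ?_⟩
    simp only [PatternExpr.value_sumCol, hv]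
    refine Finset.sum_congr rfl fun v _ => ?_
    rw [Function.update_comp_eq_of_injective _ (Fin.castLE_injective hl)]

/-- **Padding with idle labels, closed polynomials**: the twin's `close` is the original's rescaled by
`n^{K-k} · n^{L-l}` (each idle label is summed over `n` values). [folklore] -/
theorem exists_close_eq_pad {K L : ℕ} (hk : k ≤ K) (hl : l ≤ L) (n : ℕ) (e : PatternExpr F k l) :
    ∃ e' : PatternExpr F K L, e'.length = e.length ∧ e'.close n = (n ^ (K - k) * n ^ (L - l)) • e.close n := by
  obtain ⟨e', hlen, hv⟩ := exists_value_eq_pad hk hl n e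
  refine ⟨e', hlen, ?_⟩
  rw [PatternExpr.close, PatternExpr.close]
  have h1 : ∀ ρ : Fin K → Fin n, ∑ γ : Fin L → Fin n, e'.value n ρ γ =
      n ^ (L - l) • ∑ γ' : Fin l → Fin n, e.value n (ρ ∘ Fin.castLE hk) γ' := by
    intro ρ
    rw [← OrbitSupport.sum_comp_castLE hl (fun γ' : Fin l → Fin n => e.value n (ρ ∘ Fin.castLE hk) γ')]
    exact Finset.sum_congr rfl fun γ _ => hv ρ γ
  simp_rw [h1]
  rw [← Finset.smul_sum, OrbitSupport.sum_comp_castLE hk (fun ρ' : Fin k → Fin n =>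
    ∑ γ' : Fin l → Fin n, e.value n ρ' γ'), smul_smul, mul_comm]

/-- **Label collapse at level `n = 1`, values**: at `n = 1` every label points at the single vertex, so an
expression with any numbers of labels has a twin with ONE row and ONE column label, of the same length and the
same value. [folklore] -/
theorem exists_value_eq_collapse :
    ∀ e : PatternExpr F k l, ∃ e₀ : PatternExpr F 1 1, e₀.length = e.length ∧
      ∀ (ρ : Fin k → Fin 1) (γ : Fin l → Fin 1) (ρ₀ : Fin 1 → Fin 1) (γ₀ : Fin 1 → Fin 1),
        e₀.value 1 ρ₀ γ₀ = e.value 1 ρ γ := by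
  intro e
  induction e with
  | edge a b =>
    refine ⟨PatternExpr.edge 0 0, rfl, fun ρ γ ρ₀ γ₀ => ?_⟩
    rw [PatternExpr.value_edge, PatternExpr.value_edge, Subsingleton.elim (ρ₀ 0) (ρ a),
      Subsingleton.elim (γ₀ 0) (γ b)]
  | const c => exact ⟨PatternExpr.const c, rfl, fun ρ γ ρ₀ γ₀ => by simp⟩
  | add e₁ e₂ ih₁ ih₂ =>
    obtain ⟨e₁', h₁, hv₁⟩ := ih₁
    obtain ⟨e₂', h₂, hv₂⟩ := ih₂
    exact ⟨PatternExpr.add e₁' e₂', by simp [PatternExpr.length, h₁, h₂], fun ρ γ ρ₀ γ₀ => by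
      rw [PatternExpr.value_add, PatternExpr.value_add, hv₁ ρ γ, hv₂ ρ γ]⟩
  | mul e₁ e₂ ih₁ ih₂ =>
    obtain ⟨e₁', h₁, hv₁⟩ := ih₁
    obtain ⟨e₂', h₂, hv₂⟩ := ih₂
    exact ⟨PatternExpr.mul e₁' e₂', by simp [PatternExpr.length, h₁, h₂], fun ρ γ ρ₀ γ₀ => by
      rw [PatternExpr.value_mul, PatternExpr.value_mul, hv₁ ρ γ, hv₂ ρ γ]⟩
  | sumRow a e ih =>
    obtain ⟨e', h, hv⟩ := ih
    exact ⟨PatternExpr.sumRow 0 e', by simp [PatternExpr.length, h], fun ρ γ ρ₀ γ₀ => by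
      rw [PatternExpr.value_sumRow, PatternExpr.value_sumRow]
      exact Finset.sum_congr rfl fun v _ => hv _ _ _ _⟩
  | sumCol b e ih =>
    obtain ⟨e', h, hv⟩ := ih
    exact ⟨PatternExpr.sumCol 0 e', by simp [PatternExpr.length, h], fun ρ γ ρ₀ γ₀ => by
      rw [PatternExpr.value_sumCol, PatternExpr.value_sumCol]
      exact Finset.sum_congr rfl fun v _ => hv _ _ _ _⟩

/-- **Label collapse at level `n = 1`, closed polynomials**: same length, same `close 1`, one label a side.
[folklore] -/
theorem exists_close_eq_collapse (e : PatternExpr F k l) :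
    ∃ e₀ : PatternExpr F 1 1, e₀.length = e.length ∧ e₀.close 1 = e.close 1 := by
  obtain ⟨e₀, hlen, hv⟩ := exists_value_eq_collapse e
  refine ⟨e₀, hlen, ?_⟩
  simp only [PatternExpr.close, Fintype.sum_unique]
  exact hv _ _ _ _

end SingleLevel

/-! ### Arithmetic -/

section Arithmetic

/-- For `n ≥ 2`, `n^m ≤ 2^M` forces `m ≤ M`. [folklore] -/
theorem labels_le_of_pow_le {n m M : ℕ} (hn : 2 ≤ n) (h : n ^ m ≤ 2 ^ M) : m ≤ M :=
  (Nat.pow_le_pow_iff_right (by norm_num : 1 < 2)).1 ((Nat.pow_le_pow_left hn m).trans h)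

/-- Combining two quasi-polynomial quantities: `(X + 2)(Y + 2) ≤ 2^{(log₂ n + c)^c}` with `c = max a b + 2`.
[folklore] -/
theorem qp_combine (a b : ℕ) : ∃ c : ℕ, ∀ L X Y : ℕ, X ≤ 2 ^ ((L + a) ^ a) → Y ≤ 2 ^ ((L + b) ^ b) →
    (X + 2) * (Y + 2) ≤ 2 ^ ((L + c) ^ c) := by
  refine ⟨max a b + 2, fun L X Y hX hY => ?_⟩
  set m := max a b with hm
  set M := (L + m) ^ m with hM
  have hA : (L + a) ^ a ≤ M := CompressionFloors.polylog_mono (le_max_left a b)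
  have hB : (L + b) ^ b ≤ M := CompressionFloors.polylog_mono (le_max_right a b)
  have hM1 : 1 ≤ M := by
    rcases Nat.eq_zero_or_pos m with h0 | h0
    · simp [hM, h0]
    · exact Nat.one_le_pow _ _ (by omega)
  have h2M : 2 ≤ 2 ^ M := by
    calc 2 = 2 ^ 1 := by norm_num
      _ ≤ 2 ^ M := Nat.pow_le_pow_right (by norm_num) hM1
  have hX' : X + 2 ≤ 2 ^ (M + 1) := by
    have := hX.trans (Nat.pow_le_pow_right (by norm_num) hA)
    rw [pow_succ]; omega
  have hY' : Y + 2 ≤ 2 ^ (M + 1) := by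
    have := hY.trans (Nat.pow_le_pow_right (by norm_num) hB)
    rw [pow_succ]; omega
  have hexp : (M + 1) + (M + 1) ≤ (L + (m + 2)) ^ (m + 2) := by
    have hb : (L + m) ^ m ≤ (L + (m + 2)) ^ m := Nat.pow_le_pow_left (by omega) m
    calc (M + 1) + (M + 1) ≤ 4 * M := by omega
      _ ≤ (L + (m + 2)) ^ 2 * (L + (m + 2)) ^ m := by
          refine Nat.mul_le_mul ?_ (hM.le.trans hb)
          have h2 : 2 ≤ L + (m + 2) := by omega
          calc 4 = 2 ^ 2 := by norm_num
            _ ≤ (L + (m + 2)) ^ 2 := Nat.pow_le_pow_left h2 2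
      _ = (L + (m + 2)) ^ (m + 2) := by rw [← pow_add, add_comm 2 m]
  calc (X + 2) * (Y + 2) ≤ 2 ^ (M + 1) * 2 ^ (M + 1) := Nat.mul_le_mul hX' hY'
    _ = 2 ^ ((M + 1) + (M + 1)) := by rw [← pow_add]
    _ ≤ 2 ^ ((L + (m + 2)) ^ (m + 2)) := Nat.pow_le_pow_right (by norm_num) hexp

end Arithmetic

/-! ### Family level: the class of narrow families of quasi-polynomial length is closed under scalars,
sums and products -/

section Family

/-- **Scalar families**: if `f` is narrow of quasi-polynomial length then so is `n ↦ a n • f n`. [folklore] -/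
theorem narrowQP_smul (f : (n : ℕ) → MvPolynomial (Fin n × Fin n) ℂ) (a : ℕ → ℂ)
    (hf : ∃ c : ℕ, ∀ n : ℕ, 1 ≤ n → ∃ (k l : ℕ) (e : PatternExpr ℂ k l),
      n ^ (k + l) ≤ 2 ^ ((Nat.log 2 n + c) ^ c) ∧ e.length ≤ 2 ^ ((Nat.log 2 n + c) ^ c) ∧
      e.close n = f n) :
    ∃ c : ℕ, ∀ n : ℕ, 1 ≤ n → ∃ (k l : ℕ) (e : PatternExpr ℂ k l),
      n ^ (k + l) ≤ 2 ^ ((Nat.log 2 n + c) ^ c) ∧ e.length ≤ 2 ^ ((Nat.log 2 n + c) ^ c) ∧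
      e.close n = a n • f n := by
  obtain ⟨c, hc⟩ := hf
  obtain ⟨c₁, hc₁⟩ := qp_combine c 0
  refine ⟨max c c₁, fun n hn => ?_⟩
  obtain ⟨k, l, e, hkl, hlen, hclose⟩ := hc n hn
  refine ⟨k, l, PatternExpr.mul (PatternExpr.const (a n)) e,
    hkl.trans (Nat.pow_le_pow_right (by norm_num) (CompressionFloors.polylog_mono (le_max_left _ _))),
    ?_, by rw [ShortClose.close_const_mul, hclose]⟩
  have h := hc₁ (Nat.log 2 n) e.length 0 hlen (Nat.zero_le _)
  have : (PatternExpr.mul (PatternExpr.const (a n)) e).length = e.length + 2 := by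
    simp [PatternExpr.length]; ring
  rw [this]
  calc e.length + 2 ≤ (e.length + 2) * (0 + 2) := Nat.le_mul_of_pos_right _ (by norm_num)
    _ ≤ 2 ^ ((Nat.log 2 n + c₁) ^ c₁) := h
    _ ≤ 2 ^ ((Nat.log 2 n + max c c₁) ^ max c c₁) :=
        Nat.pow_le_pow_right (by norm_num) (CompressionFloors.polylog_mono (le_max_right _ _))

/-- **Sums**: if `f` and `g` are narrow of quasi-polynomial length then so is `f + g` (pad both presentations to
common label counts, rescale the idle-label powers of `n` away, add). [folklore] -/
theorem narrowQP_add (f g : (n : ℕ) → MvPolynomial (Fin n × Fin n) ℂ)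
    (hf : ∃ c : ℕ, ∀ n : ℕ, 1 ≤ n → ∃ (k l : ℕ) (e : PatternExpr ℂ k l),
      n ^ (k + l) ≤ 2 ^ ((Nat.log 2 n + c) ^ c) ∧ e.length ≤ 2 ^ ((Nat.log 2 n + c) ^ c) ∧
      e.close n = f n)
    (hg : ∃ c : ℕ, ∀ n : ℕ, 1 ≤ n → ∃ (k l : ℕ) (e : PatternExpr ℂ k l),
      n ^ (k + l) ≤ 2 ^ ((Nat.log 2 n + c) ^ c) ∧ e.length ≤ 2 ^ ((Nat.log 2 n + c) ^ c) ∧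
      e.close n = g n) :
    ∃ c : ℕ, ∀ n : ℕ, 1 ≤ n → ∃ (k l : ℕ) (e : PatternExpr ℂ k l),
      n ^ (k + l) ≤ 2 ^ ((Nat.log 2 n + c) ^ c) ∧ e.length ≤ 2 ^ ((Nat.log 2 n + c) ^ c) ∧
      e.close n = f n + g n := by
  obtain ⟨a, ha⟩ := hf
  obtain ⟨b, hb⟩ := hg
  obtain ⟨c, hc⟩ := qp_combine a b
  refine ⟨c, fun n hn => ?_⟩
  obtain ⟨k, l, e, hkl, hlen, hclose⟩ := ha n hn
  obtain ⟨k', l', e', hkl', hlen', hclose'⟩ := hb n hn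
  -- pad both to `(max k k', max l l')`
  obtain ⟨E, hE, hEc⟩ := exists_close_eq_pad (le_max_left k k') (le_max_left l l') n e
  obtain ⟨E', hE', hEc'⟩ := exists_close_eq_pad (le_max_right k k') (le_max_right l l') n e'
  set N : ℕ := n ^ (max k k' - k) * n ^ (max l l' - l) with hN
  set N' : ℕ := n ^ (max k k' - k') * n ^ (max l l' - l') with hN'
  have hn0 : 0 < n := hn
  have hNz : (N : ℂ) ≠ 0 := Nat.cast_ne_zero.2 (by positivity)
  have hN'z : (N' : ℂ) ≠ 0 := Nat.cast_ne_zero.2 (by positivity)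
  refine ⟨max k k', max l l', PatternExpr.add (PatternExpr.mul (PatternExpr.const ((N : ℂ)⁻¹)) E)
    (PatternExpr.mul (PatternExpr.const ((N' : ℂ)⁻¹)) E'), ?_, ?_, ?_⟩
  · -- labels: `n^{K+L} ≤ n^{k+l} · n^{k'+l'}`
    have hKL : max k k' + max l l' ≤ (k + l) + (k' + l') := by omega
    calc n ^ (max k k' + max l l') ≤ n ^ ((k + l) + (k' + l')) := Nat.pow_le_pow_right hn0 hKL
      _ = n ^ (k + l) * n ^ (k' + l') := pow_add _ _ _
      _ ≤ (n ^ (k + l) + 2) * (n ^ (k' + l') + 2) := Nat.mul_le_mul (by omega) (by omega)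
      _ ≤ 2 ^ ((Nat.log 2 n + c) ^ c) := hc _ _ _ hkl hkl'
  · -- length: `|e| + |e'| + 5 ≤ (|e| + 2)(|e'| + 2)`
    have hlenE : (PatternExpr.add (PatternExpr.mul (PatternExpr.const ((N : ℂ)⁻¹)) E)
        (PatternExpr.mul (PatternExpr.const ((N' : ℂ)⁻¹)) E')).length = e.length + e'.length + 5 := by
      simp [PatternExpr.length, hE, hE']; ring
    rw [hlenE]
    have h1 := PatternExpr.length_pos e
    have h2 := PatternExpr.length_pos e'
    calc e.length + e'.length + 5 ≤ (e.length + 2) * (e'.length + 2) := by nlinarith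
      _ ≤ 2 ^ ((Nat.log 2 n + c) ^ c) := hc _ _ _ hlen hlen'
  · rw [ShortClose.close_add, ShortClose.close_const_mul, ShortClose.close_const_mul, hEc, hEc', hclose,
      hclose', ← Nat.cast_smul_eq_nsmul ℂ N (f n), ← Nat.cast_smul_eq_nsmul ℂ N' (g n), smul_smul, smul_smul,
      inv_mul_cancel₀ hNz, inv_mul_cancel₀ hN'z, one_smul, one_smul]

/-- **Products**: if `f` and `g` are narrow of quasi-polynomial length then so is `f · g`.  For `n ≥ 2` pad and
multiply (`|e| = |e₁| + |e₂| + (K + L) + 3`, and `K + L` is polylogarithmic because `n^{K+L} ≤ 2^{polylog}` with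
`n ≥ 2`); at `n = 1` the label counts are not controlled by the hypothesis, and both presentations are first
collapsed to one label a side (`exists_close_eq_collapse`). [folklore] -/
theorem narrowQP_mul (f g : (n : ℕ) → MvPolynomial (Fin n × Fin n) ℂ)
    (hf : ∃ c : ℕ, ∀ n : ℕ, 1 ≤ n → ∃ (k l : ℕ) (e : PatternExpr ℂ k l),
      n ^ (k + l) ≤ 2 ^ ((Nat.log 2 n + c) ^ c) ∧ e.length ≤ 2 ^ ((Nat.log 2 n + c) ^ c) ∧
      e.close n = f n)
    (hg : ∃ c : ℕ, ∀ n : ℕ, 1 ≤ n → ∃ (k l : ℕ) (e : PatternExpr ℂ k l),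
      n ^ (k + l) ≤ 2 ^ ((Nat.log 2 n + c) ^ c) ∧ e.length ≤ 2 ^ ((Nat.log 2 n + c) ^ c) ∧
      e.close n = g n) :
    ∃ c : ℕ, ∀ n : ℕ, 1 ≤ n → ∃ (k l : ℕ) (e : PatternExpr ℂ k l),
      n ^ (k + l) ≤ 2 ^ ((Nat.log 2 n + c) ^ c) ∧ e.length ≤ 2 ^ ((Nat.log 2 n + c) ^ c) ∧
      e.close n = f n * g n := by
  obtain ⟨a, ha⟩ := hf
  obtain ⟨b, hb⟩ := hg
  obtain ⟨c, hc⟩ := qp_combine a b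
  refine ⟨c, fun n hn => ?_⟩
  obtain ⟨k, l, e, hkl, hlen, hclose⟩ := ha n hn
  obtain ⟨k', l', e', hkl', hlen', hclose'⟩ := hb n hn
  have h1 := PatternExpr.length_pos e
  have h2 := PatternExpr.length_pos e'
  rcases Nat.lt_or_ge n 2 with hn1 | hn2
  · -- `n = 1`: collapse the labels, then multiply
    obtain rfl : n = 1 := by omega
    obtain ⟨E, hE, hEc⟩ := exists_close_eq_collapse e
    obtain ⟨E', hE', hEc'⟩ := exists_close_eq_collapse e'
    obtain ⟨P, hP, hPc⟩ := exists_close_eq_mul_len 1 E E'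
    refine ⟨1, 1, P, by simpa using Nat.one_le_two_pow, ?_, by rw [hPc, hEc, hEc', hclose, hclose']⟩
    rw [hP, hE, hE']
    calc e.length + e'.length + (1 + 1) + 1 ≤ (e.length + 2) * (e'.length + 2) := by nlinarith
      _ ≤ _ := hc _ _ _ hlen hlen'
  · -- `n ≥ 2`: pad to common label counts, multiply, rescale
    obtain ⟨E, hE, hEc⟩ := exists_close_eq_pad (le_max_left k k') (le_max_left l l') n e
    obtain ⟨E', hE', hEc'⟩ := exists_close_eq_pad (le_max_right k k') (le_max_right l l') n e'
    obtain ⟨P, hP, hPc⟩ := exists_close_eq_mul_len n E E'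
    set N : ℕ := n ^ (max k k' - k) * n ^ (max l l' - l) with hN
    set N' : ℕ := n ^ (max k k' - k') * n ^ (max l l' - l') with hN'
    have hn0 : 0 < n := hn
    have hNz : ((N * N' : ℕ) : ℂ) ≠ 0 := Nat.cast_ne_zero.2 (by positivity)
    refine ⟨max k k', max l l', PatternExpr.mul (PatternExpr.const (((N * N' : ℕ) : ℂ))⁻¹) P, ?_, ?_, ?_⟩
    · have hKL : max k k' + max l l' ≤ (k + l) + (k' + l') := by omega
      calc n ^ (max k k' + max l l') ≤ n ^ ((k + l) + (k' + l')) := Nat.pow_le_pow_right hn0 hKL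
        _ = n ^ (k + l) * n ^ (k' + l') := pow_add _ _ _
        _ ≤ (n ^ (k + l) + 2) * (n ^ (k' + l') + 2) := Nat.mul_le_mul (by omega) (by omega)
        _ ≤ 2 ^ ((Nat.log 2 n + c) ^ c) := hc _ _ _ hkl hkl'
    · -- length `= |e| + |e'| + (K + L) + 3`, `K + L ≤ M_a + M_b ≤ X + Y`
      have hKa : k + l ≤ (Nat.log 2 n + a) ^ a := labels_le_of_pow_le hn2 hkl
      have hKb : k' + l' ≤ (Nat.log 2 n + b) ^ b := labels_le_of_pow_le hn2 hkl'
      have hMa : (Nat.log 2 n + a) ^ a ≤ 2 ^ ((Nat.log 2 n + a) ^ a) := (Nat.lt_two_pow_self).le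
      have hMb : (Nat.log 2 n + b) ^ b ≤ 2 ^ ((Nat.log 2 n + b) ^ b) := (Nat.lt_two_pow_self).le
      have hlenP : (PatternExpr.mul (PatternExpr.const (((N * N' : ℕ) : ℂ))⁻¹) P).length =
          e.length + e'.length + (max k k' + max l l') + 3 := by
        simp [PatternExpr.length, hP, hE, hE']; ring
      rw [hlenP]
      have hKL : max k k' + max l l' ≤ (k + l) + (k' + l') := by omega
      set X := 2 ^ ((Nat.log 2 n + a) ^ a) with hX
      set Y := 2 ^ ((Nat.log 2 n + b) ^ b) with hY
      calc e.length + e'.length + (max k k' + max l l') + 3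
          ≤ X + Y + (X + Y) + 3 := by omega
        _ ≤ (X + 2) * (Y + 2) := by nlinarith
        _ ≤ 2 ^ ((Nat.log 2 n + c) ^ c) := hc _ _ _ le_rfl le_rfl
    · rw [ShortClose.close_const_mul, hPc, hEc, hEc', hclose, hclose', ← Nat.cast_smul_eq_nsmul ℂ N,
        ← Nat.cast_smul_eq_nsmul ℂ N', smul_mul_smul_comm, smul_smul, ← Nat.cast_mul,
        inv_mul_cancel₀ hNz, one_smul]

end Family

end NarrowClosure

end Summit.ValiantsHypothesis.ValiantsHypothesis.Theorems

end
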